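import Literature.NumberTheory.EllipticCurves.Kato2004.IwasawaH1ReductionPk
import Literature.NumberTheory.EllipticCurves.LocalKummerMap
import Literature.NumberTheory.EllipticCurves.Castella2018.PAdicWaldspurgerFormula
import Mathlib.NumberTheory.Padics.HeightOneSpectrum
import HarnessLib

/-!
# `HasLocPKummerLog W p x t`: "the localisation at `p` of the global class `x ∈ H¹(ℚ, T_pW)` is a
# Kummer class with formal-group logarithm `t`" — Perrin-Riou's / Bloch–Kato's `log(loc_p x)` in the
# FINITE-LEVEL KUMMER CURRENCY of the tree (no `B_cris`, no `B_dR`)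

Topic `NumberTheory/EllipticCurves`, sub-directory `Kato2004` (namespace = path). Definition item
`defn-HasLocPKummerLog` (ledger; wanted by stmt-BirchSwinnertonDyer-19080 / -19160), typed per the plan
seat's decision `run/shared/lean/pub/bsd-cn100/bsd-cn100-plan/DEFN-DECISIONS-g13.md` §Q2 ("ty's
FINITE-LEVEL currency, simplified to ONE local point"). Cell `bsd-cn100`, prover seat `bsd-cn100-s2-c3`
(g7). HONEST FRAMING: DEFINITIONS with bodies (plumbing maps + one `Prop`) and unfolding lemmas; nothing
is asserted, no named fact is minted, no instance / notation is declared; nothing about BSD is proved.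

## The notion (Bloch–Kato 1990 Ex. 3.11; Burungale–Skinner, App. A to arXiv:2210.10730, §10.1.2)

For `E/ℚ` and a prime `p`, `H¹_f(ℚ_p, V) ⊂ H¹(ℚ_p, V)` (`V = T_pE ⊗ ℚ_p`) is "the subgroup arising from
the Kummer image of `E(ℚ_p)`" [B–S §10.1.2], and `log : H¹_f(ℚ_p, V) → ℚ_p` is "the logarithm map
associated to the Néron differential" [B–S Thm. 10.8 (a)], i.e. `log(κ_p(Q) ⊗ 1) = log_ω(Q)`, the
formal-group logarithm of `Q ∈ E(ℚ_p)` extended `ℤ_p`-linearly from `E₁(ℚ_p)`. Since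
`E(ℚ_p) ≅ ℤ_p × (finite)` is `p`-adically complete and `H¹(ℚ_p, T_pE) = lim←_k H¹(ℚ_p, E[p^k])`
(finite `H⁰`'s), the statement «`loc_p(x) ⊗ 1 ∈ H¹_f(ℚ_p, V)` with `log(loc_p x) = t`» is EQUIVALENT to
its finite-level form: «for some integer `m ≠ 0` and some point `Q ∈ E(ℚ_p)`, the reduction modulo
`p^k` of `loc_p(m·x)` is the local Kummer class of `Q` at EVERY level `p^k`, and `log_ω(Q) = m·t`».
That is the definition below; every map in it is a tree object:

* `reduceH1Pk W p k U : H¹(U, T_pW) →+ H¹(U, W[p^k])` (bsd-cn100-ty's `Kato2004/IwasawaH1ReductionPk.lean`,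
  p461530: `mapH1AddHom` along `tateModPk = TateModule.proj p k`, the mod-`p^k` twin of bsd-smallim's
  `tateModP`/`reduceH1`; its `redZeroPk` is the same map precomposed with `projZero`);
* `ofTopSubgroup` (tree): `H¹(⊤, ·) → H¹(Γ_ℚ, ·)`; `galoisCohomology.res … (ℚ_v) 1` (tree): restriction
  to `Γ_{ℚ_v}` along `absGaloisRestrict ℚ ℚ_v` — the localisation `loc_p`, with `ℚ_v =
  v.adicCompletion ℚ` for the place `v = primePlace p` of `ℚ` above `p` (Mathlib `primesEquiv`);
* `WeierstrassCurve.localKummerMap W ℚ_v (hn) : E(ℚ_v) →+ H¹(Γ_{ℚ_v}, E[n])` (tree, AEC X §4 (**));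
  the witness point `Q ∈ E(ℚ_p)` is read in `E(ℚ_v)` along Mathlib's continuous `ℚ`-algebra
  isomorphism `Padic.adicCompletionEquiv : ℚ_[p] ≃A[ℚ] ℚ_v` (`padicToAdic`, `WeierstrassCurve.Affine.Point.map`);
* `padicLogLocal W p Q := log_W(z(m₀ • Q))/m₀`, `m₀ = [E(ℚ_p) : E₁(ℚ_p)]` (`padicLogPoint`,
  `formalIndex`) — the body of `Castella2018.padicLogOmega` for LOCAL points
  (`padicLogOmega_eq_padicLogLocal`: `log_ω` of a global point read through `ι : K →+* ℚ_p` is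
  `padicLogLocal` of its image, by `rfl`).

`x` ranges over `H1 (tateRep W p) ⊤ = H¹(Γ_ℚ, T_pW)` (continuous cochains, subgroup dialect of the
tree's `EulerSystem.H1`); a class at the bottom layer `κ.layerSubgroup 0` of a `ℤ_p`-extension (the
codomain of bsd-smallim's `IwasawaH1Data.proj 0`, where the Kato–zeta road's class `ι[z]` lives) is
moved to `⊤` by `layerZeroToTop` (restriction along `⊤ ≤ κ.layerSubgroup 0`, an isomorphism since the
two subgroups coincide, `ZpExtension.mem_layerSubgroup_zero`).

NOT here (scope): the `ℚ_p`-linearity / uniqueness of `t` (needs the additivity of `log_W ∘ z` on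
`E₁(ℚ_p)`, the tree's NAMED fact `padicLogPoint_add`, and `ker κ_{p^k} = p^k E(ℚ_p)`,
`ker_localKummerMap`), `H¹_f = ` Kummer image as a theorem (Bloch–Kato Ex. 3.11), any `B_cris`.

References: S. Bloch, K. Kato, *L-functions and Tamagawa numbers of motives* (1990), Def. 3.10,
Ex. 3.11 [BlochKato1990]; A. Burungale, C. Skinner, App. A to arXiv:2210.10730, §10.1.2 and Thm. 10.8
(p. 33) [AlpogeBhargavaShnidman2022]; B. Perrin-Riou, Ann. Inst. Fourier 43 (1993) §3.3
[PerrinRiou1993AIF]; J. Silverman, AEC (2009) IV.6.4, VII.2.2, VIII §2, X §4 [SilvermanAEC2009];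
J. Neukirch, A. Schmidt, K. Wingberg, *Cohomology of Number Fields* (2.7.5)–(2.7.6) [NeukirchSchmidtWingberg2008];
tree: `Kato2004/IwasawaH1ReductionPk.lean` (`reduceH1Pk`, `redZeroPk`), `GaloisRepresentations/EulerSystem.lean`
(`H1`, `ofTopSubgroup`), `GaloisRepresentations/GaloisCohomology.lean` (`galoisCohomology.res`),
`LocalKummerMap.lean` (`localKummerMap`), `Castella2018/PAdicWaldspurgerFormula.lean` (`padicLogOmega`),
Mathlib `NumberTheory/Padics/HeightOneSpectrum.lean` (`primesEquiv`, `Padic.adicCompletionEquiv`).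
-/

noncomputable section

open scoped Classical NumberField
open Field IsDedekindDomain CategoryTheory
open Literature.NumberTheory.GaloisRepresentations
open Literature.NumberTheory.EllipticCurves Literature.NumberTheory.EllipticCurves.Kato2004
open Literature.NumberTheory.EllipticCurves.Kato2004.EulerSystemValues
open WeierstrassCurve (geomPoints geomTorsion)

namespace Literature.NumberTheory.EllipticCurves.Kato2004

/-! ## §1 The place of `ℚ` above `p` and `ℚ_p ≅ ℚ_v` -/

section Place

variable (p : ℕ) [Fact p.Prime]

/-- **The finite place `v` of `ℚ` above the prime `p`** (`v.asIdeal = (p)`): Mathlib's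
`Rat.HeightOneSpectrum.primesEquiv : HeightOneSpectrum (𝓞 ℚ) ≃ Nat.Primes`, inverted at `⟨p, _⟩`.
[folklore] -/
def primePlace : HeightOneSpectrum (𝓞 ℚ) :=
  (Rat.HeightOneSpectrum.primesEquiv (R := 𝓞 ℚ)).symm ⟨p, Fact.out⟩

/-- `primesEquiv (primePlace p) = ⟨p, _⟩`: the place `primePlace p` lies over `p` (the finite places of
`ℚ` are the primes). [cite: NeukirchANT1999, Ch. II §2 and Ch. III §1 (places of `ℚ`)] -/
@[simp] theorem primesEquiv_primePlace :
    Rat.HeightOneSpectrum.primesEquiv (R := 𝓞 ℚ) (primePlace p) = ⟨p, Fact.out⟩ :=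
  Equiv.apply_symm_apply _ _

/-- The residue characteristic of `primePlace p` (as read by `Kato2004.integralH1`) is `p`.
[cite: NeukirchANT1999, Ch. II §2 and Ch. III §1 (places of `ℚ`)] -/
theorem coe_primesEquiv_primePlace :
    ((Rat.HeightOneSpectrum.primesEquiv (R := 𝓞 ℚ) (primePlace p) : Nat.Primes) : ℕ) = p := by
  rw [primesEquiv_primePlace]

/-- **`ℚ_p → ℚ_v`** for `v = primePlace p`: Mathlib's continuous `ℚ`-algebra isomorphism
`Padic.adicCompletionEquiv ⟨p, _⟩ : ℚ_[p] ≃A[ℚ] (primePlace p).adicCompletion ℚ`, as a `ℚ`-algebra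
homomorphism (the currency of `WeierstrassCurve.Affine.Point.map`). [folklore] -/
def padicToAdic : ℚ_[p] →ₐ[ℚ] (primePlace p).adicCompletion ℚ :=
  (Padic.adicCompletionEquiv (R := 𝓞 ℚ) ⟨p, Fact.out⟩).toAlgEquiv.toAlgHom

/-- Unfolding `padicToAdic` (`ℚ_p` is the completion of `ℚ` at `(p)`). [cite: NeukirchANT1999, Ch. II §2 (`ℚ_p` as a completion)] -/
theorem padicToAdic_apply (a : ℚ_[p]) :
    padicToAdic p a = Padic.adicCompletionEquiv (R := 𝓞 ℚ) ⟨p, Fact.out⟩ a :=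
  rfl

/-- `padicToAdic` is injective (it underlies the isomorphism `ℚ_p ≅ ℚ_v`). [cite: NeukirchANT1999, Ch. II §2 (`ℚ_p` as a completion)] -/
theorem padicToAdic_injective : Function.Injective (padicToAdic p) :=
  (Padic.adicCompletionEquiv (R := 𝓞 ℚ) ⟨p, Fact.out⟩).injective

end Place

/-! ## §2 `loc_p` at level `p^k` (over bsd-cn100-ty's `reduceH1Pk`), from the bottom layer to `⊤`,
the local logarithm -/

section Reduction

variable (W : WeierstrassCurve ℚ) [W.IsElliptic] (p : ℕ) [Fact p.Prime]
  [ContinuousSMul ℤ_[p] (W.tateModule p)]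


/-- **`loc_p` modulo `p^k`**: `H¹(Γ_ℚ, T_pW) → H¹(Γ_{ℚ_v}, W[p^k])`, `v = primePlace p`,
`ℚ_v = v.adicCompletion ℚ`: reduce the coefficients modulo `p^k` (`reduceH1Pk … ⊤`), pass from the
subgroup `⊤` to `Γ_ℚ` (`ofTopSubgroup`), and restrict to the decomposition group `Γ_{ℚ_v} → Γ_ℚ`
(`galoisCohomology.res`, along `absGaloisRestrict ℚ ℚ_v`). The target is the codomain of the tree's
local Kummer map `WeierstrassCurve.localKummerMap W ℚ_v`. [cite: AlpogeBhargavaShnidman2022, App. A §10.1.2 (p. 33) (`loc_p`)]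
[cite: SilvermanAEC2009, X.§4 diagram (**) (the local restriction maps)] -/
def locModPk (k : ℕ) :
    H1 (tateRep W p) ⊤ →+
      galoisCohomology ((W.torsionGaloisModule ((p : ℤ) ^ k)).restrictField
        ((primePlace p).adicCompletion ℚ)) 1 :=
  ((galoisCohomology.res (W.torsionGaloisModule ((p : ℤ) ^ k)) ((primePlace p).adicCompletion ℚ)
      1).comp
    (ofTopSubgroup (W.torsionGaloisModule ((p : ℤ) ^ k)).toTopRep 1).hom.toLinearMap.toAddMonoidHom).comp
    (reduceH1Pk W p k ⊤)

/-- Unfolding `locModPk`. [cite: AlpogeBhargavaShnidman2022, App. A §10.1.2 (p. 33)] -/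
theorem locModPk_apply (k : ℕ) (x : H1 (tateRep W p) ⊤) :
    locModPk W p k x =
      galoisCohomology.res (W.torsionGaloisModule ((p : ℤ) ^ k)) ((primePlace p).adicCompletion ℚ) 1
        ((ofTopSubgroup (W.torsionGaloisModule ((p : ℤ) ^ k)).toTopRep 1).hom
          (reduceH1Pk W p k ⊤ x)) :=
  rfl

/-- **From the bottom layer of a `ℤ_p`-extension to `⊤`**: `H¹(κ.layerSubgroup 0, T_pW) ⟶ H¹(⊤, T_pW)`,
the restriction along `⊤ ≤ κ.layerSubgroup 0` (the two subgroups of `Γ_ℚ` coincide,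
`ZpExtension.mem_layerSubgroup_zero`, so this is an isomorphism; only the map is needed here). It moves
the codomain of bsd-smallim's `IwasawaH1Data.proj 0` — where the Kato–zeta road's class `ι[z]` lives —
into the domain of `HasLocPKummerLog`. [cite: Kato2004Asterisque, §14.14 (14.14.1) (p. 243)] -/
def layerZeroToTop (κ : ZpExtension ℚ p) :
    H1 (tateRep W p) (κ.layerSubgroup 0) ⟶ H1 (tateRep W p) ⊤ :=
  resLe (tateRep W p).toTopRep (fun g _ ↦ ZpExtension.mem_layerSubgroup_zero κ g) 1

omit [ContinuousSMul ℤ_[p] (W.tateModule p)] in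
/-- **`log_ω` on LOCAL points**: for `Q ∈ E(ℚ_p)` (`W` globally minimal, so `ω_W` is a Néron
differential and `W ⊗ ℚ_p` is `ℤ_p`-minimal), `log_ω(Q) := log_W(z(m₀ • Q))/m₀` with
`m₀ = [E(ℚ_p) : E₁(ℚ_p)]` (`formalIndex`) — the `ℤ_p`-linear extension of the formal-group logarithm
`padicLogPoint = log_W ∘ z` (AEC IV.6.4 / VII.2.2) from `E₁(ℚ_p)` to `E(ℚ_p)`; = "the logarithm map
associated to the Néron differential" of B–S Thm. 10.8 (a) on the Kummer image. Same body as
`Castella2018.padicLogOmega` (which reads a GLOBAL point through an embedding first).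
[cite: AlpogeBhargavaShnidman2022, App. A Thm. 10.8 (a) (p. 33)] [cite: SilvermanAEC2009, IV.6.4 and VII.2.2] -/
def padicLogLocal [W.IsGloballyMinimal] (Q : (W.baseChange ℚ_[p]).toAffine.Point) : ℚ_[p] :=
  (W.baseChange ℚ_[p]).padicLogPoint (formalIndex W p • Q) / (formalIndex W p : ℚ_[p])

omit [ContinuousSMul ℤ_[p] (W.tateModule p)] in
/-- `log_ω` of a global point `P ∈ E(K)` read through `ι : K →+* ℚ_p` (Castella's `padicLogOmega`) IS
`padicLogLocal` of its image `padicPointOf W p ι P ∈ E(ℚ_p)` — by `rfl`.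
[cite: Castella2018, §2.2 and Thm. 2.3 (arXiv:1704.06608 p. 5)] -/
theorem padicLogOmega_eq_padicLogLocal [W.IsGloballyMinimal] {K : Type} [Field K] [NumberField K]
    (ι : K →+* ℚ_[p]) (P : (W.baseChange K).toAffine.Point) :
    Castella2018.padicLogOmega W p ι P = padicLogLocal W p (padicPointOf W p ι P) :=
  rfl

/-! ## §3 The notion -/

/-- **`HasLocPKummerLog W p x t`: "the localisation at `p` of the global class `x ∈ H¹(ℚ, T_pW)` is a
Kummer class with formal-group logarithm `t`"** — in finite-level currency: there are an integer
`m ≠ 0` and ONE point `Q ∈ E(ℚ_p)` such that, at EVERY level `p^k`, the reduction modulo `p^k` of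
`loc_p(m • x)` is the local Kummer class of `Q` (read in `E(ℚ_v)`, `v = primePlace p`, along
`ℚ_p ≅ ℚ_v`), and `log_ω(Q) = m · t`. Faithful to «`loc_p(x) ⊗ 1 ∈ H¹_f(ℚ_p, V)` (the Kummer image,
Bloch–Kato Ex. 3.11) with `log(loc_p x) = t`» because `E(ℚ_p)` is `p`-adically complete and
`H¹(ℚ_p, T_p) = lim←_k H¹(ℚ_p, W[p^k])`; the factor `m` absorbs the torsion of `H¹(ℚ_p, T_p)` and the
`ℤ`-vs-`ℚ` scaling. For `W` globally minimal (Néron differential); the `ContinuousSMul ℤ_[p] (T_pW)`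
structure fact is an instance binder (supply `TateModule.continuousSMul_padicInt`). A `Prop`; nothing
asserted. [cite: BlochKato1990, Def. 3.10 and Ex. 3.11] [cite: AlpogeBhargavaShnidman2022, App. A §10.1.2 and Thm. 10.8 (a) (p. 33)]
[cite: PerrinRiou1993AIF, §3.3] -/
def HasLocPKummerLog [W.IsGloballyMinimal] (x : H1 (tateRep W p) ⊤) (t : ℚ_[p]) : Prop :=
  ∃ (m : ℕ) (Q : (W.baseChange ℚ_[p]).toAffine.Point), m ≠ 0 ∧
    (∀ k : ℕ, locModPk W p k (m • x) =
      W.localKummerMap ((primePlace p).adicCompletion ℚ) (pow_ne_zero k (Int.natCast_ne_zero.mpr (Fact.out : p.Prime).ne_zero))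
        (WeierstrassCurve.Affine.Point.map (padicToAdic p) Q)) ∧
    padicLogLocal W p Q = (m : ℚ_[p]) * t

/-- Unfolding `HasLocPKummerLog`. [cite: BlochKato1990, Ex. 3.11] -/
theorem hasLocPKummerLog_iff [W.IsGloballyMinimal] (x : H1 (tateRep W p) ⊤) (t : ℚ_[p]) :
    HasLocPKummerLog W p x t ↔
      ∃ (m : ℕ) (Q : (W.baseChange ℚ_[p]).toAffine.Point), m ≠ 0 ∧
        (∀ k : ℕ, locModPk W p k (m • x) =
          W.localKummerMap ((primePlace p).adicCompletion ℚ) (pow_ne_zero k (Int.natCast_ne_zero.mpr (Fact.out : p.Prime).ne_zero))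
            (WeierstrassCurve.Affine.Point.map (padicToAdic p) Q)) ∧
        padicLogLocal W p Q = (m : ℚ_[p]) * t :=
  Iff.rfl

/-- The witness data of `HasLocPKummerLog` in the shape the Kato–zeta road consumes: a multiplier
`m ≠ 0` and a local point `Q` whose level-`p^k` Kummer classes are those of `m • x` and whose
logarithm is `m · t`. [cite: AlpogeBhargavaShnidman2022, App. A Thm. 10.8 (a) (p. 33)] -/
theorem HasLocPKummerLog.exists_point [W.IsGloballyMinimal] {x : H1 (tateRep W p) ⊤} {t : ℚ_[p]}
    (h : HasLocPKummerLog W p x t) :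
    ∃ (m : ℕ) (Q : (W.baseChange ℚ_[p]).toAffine.Point), m ≠ 0 ∧
      padicLogLocal W p Q = (m : ℚ_[p]) * t ∧
      ∀ k : ℕ, locModPk W p k (m • x) =
        W.localKummerMap ((primePlace p).adicCompletion ℚ) (pow_ne_zero k (Int.natCast_ne_zero.mpr (Fact.out : p.Prime).ne_zero))
          (WeierstrassCurve.Affine.Point.map (padicToAdic p) Q) := by
  obtain ⟨m, Q, hm, hk, hlog⟩ := h
  exact ⟨m, Q, hm, hlog, hk⟩

/-- If the logarithm prescribed by `HasLocPKummerLog` is non-zero then the witness point has non-zero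
`log_ω` — the form in which the Kato–zeta road turns «`log(loc_p z) = c · log_ω(P)²`, `c ≠ 0`,
`log(loc_p z) ≠ 0`» into «`log_ω(P) ≠ 0`». [cite: AlpogeBhargavaShnidman2022, App. A §10.1.3 (p. 34)] -/
theorem HasLocPKummerLog.exists_padicLogLocal_ne_zero [W.IsGloballyMinimal] {x : H1 (tateRep W p) ⊤}
    {t : ℚ_[p]} (h : HasLocPKummerLog W p x t) (ht : t ≠ 0) :
    ∃ Q : (W.baseChange ℚ_[p]).toAffine.Point, padicLogLocal W p Q ≠ 0 ∧
      ∃ m : ℕ, m ≠ 0 ∧ ∀ k : ℕ, locModPk W p k (m • x) =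
        W.localKummerMap ((primePlace p).adicCompletion ℚ) (pow_ne_zero k (Int.natCast_ne_zero.mpr (Fact.out : p.Prime).ne_zero))
          (WeierstrassCurve.Affine.Point.map (padicToAdic p) Q) := by
  obtain ⟨m, Q, hm, hk, hlog⟩ := h
  refine ⟨Q, ?_, m, hm, hk⟩
  rw [hlog]
  exact mul_ne_zero (by exact_mod_cast hm) ht

end Reduction

end Literature.NumberTheory.EllipticCurves.Kato2004

end
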